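import Literature.AnabelianGeometry.AbsoluteAnabelian.AbsAnabLevelReciprocityProofs
import Literature.AnabelianGeometry.AbsoluteAnabelian.MLFGaloisGroupsHolds
import Literature.AnabelianGeometry.AbsoluteAnabelian.GaloisCyclotomeFunctoriality
import Literature.NumberTheory.PAdicHodge.PadicBaseField
import HarnessLib

/-!
# [AbsAnab] Prop 1.2.1 (iii)/(iv)/(vii) at a finite Galois level: `ψ_E := Art_{E₂}⁻¹ ∘ α^{ab} ∘ Art_{E₁}`

Proof-only companion (abc-iut layer L4, sub-node `AbsAnab:Prop1.2.1(vii)/L02 UnitsTransport`, step 2/4).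
S. Mochizuki, *The Absolute Anabelian Geometry of Hyperbolic Curves* (2004) [AbsAnab], proof of
Prop 1.2.1 p. 11: the identification of multiplicative groups "group-theoretic, by (iii)" —
for an isomorphism `α : G_{K₁} ≅ G_{K₂}` and open subgroups `G_{L₁} = U`, `α(U) = G_{L₂}`, the map
`Art_{L₂}⁻¹ ∘ (α|_U)^{ab} ∘ Art_{L₁}` on `Im(L₁^×) ⊆ U^{ab}`, which by (iii) ("`α^{ab}` preserves the
images `Im(𝒪^×)`, `Im(K^×)`") is an isomorphism `L₁^× ⥲ L₂^×` carrying units to units, and by (iv)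
("preserves the Frobenius elements") uniformisers to uniformisers.

For MLFs `K₁, K₂` (valued form), `α`, finite Galois `E₁/K₁`, `E₂/K₂` (local-field types) whose
subgroups correspond (`g ∈ Gal(K̄₁/E₁⁰) ↔ α g ∈ Gal(K̄₂/E₂⁰)`), `exists_levelIso` produces
`ψ : E₁⁰ˣ ≃* E₂⁰ˣ` with: (1) `Art₂ (ψ u) = [α h]` whenever `Art₁ u = [h]`, for ALL reciprocity maps
characterised by Serre's `θ` (`levelArt_unique`); (2) `ψ (g u) = α(g) ψ(u)` (`Γ_{K₁}`-equivariance,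
Neukirch IV (5.8)); (3) units `↔` units; (4) uniformisers `↦` uniformisers.  Inputs BY NAME:
`exists_reciprocity_characterized_embField`, `galoisMLF_iso_unitImage_holds` (Prop 1.2.1 (iii)),
`galoisMLF_iso_frobenius_holds` (Prop 1.2.1 (iv)) through the `ℚ_p`-binder bridge of
`MLFUnitImageReductionProofs`, and the level facts of `AbsAnabLevelReciprocityProofs`.
Universe `0` (the reach of `galoisMLF_iso_unitImage_holds`).  No definitions, no new named facts;
classical LCFT.  HONEST FRAMING: nothing here bears on [IUTchIII] Cor. 3.12.
-/

noncomputable section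

open Field IsNonarchimedeanLocalField ValuativeRel
open scoped Pointwise

namespace Literature.AnabelianGeometry.AbsoluteAnabelian

open Literature.NumberTheory.GaloisRepresentations
open Literature.NumberTheory.GaloisRepresentations.IsNonarchimedeanLocalField
open Literature.NumberTheory.GaloisRepresentations.LocalWeilDatum
open AbstractCFT AbstractCFT.WeilDatum

/-! ### Prop 1.2.1 (iv) in the valued model: `α` carries Frobenius lifts to Frobenius lifts -/

/-- [AbsAnab] Prop 1.2.1 (iv) in the tree's valued vocabulary: an isomorphism of profinite groups
between absolute Galois groups of MLFs (valued form) carries arithmetic Frobenius elements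
(`IsFrobPow σ 1`) to arithmetic Frobenius elements — `galoisMLF_iso_frobenius_holds` through the
`ℚ_p`-binder bridge `isFrobeniusLiftMLF_iff_isFrobPow_one`. [cite: MochizukiAbsAnab2004, Prop 1.2.1 (iv) p.10] -/
theorem isFrobPow_one_map_of_continuousMulEquiv {K₁ K₂ : Type} [Field K₁] [ValuativeRel K₁]
    [TopologicalSpace K₁] [IsNonarchimedeanLocalField K₁] [CharZero K₁] [Field K₂] [ValuativeRel K₂]
    [TopologicalSpace K₂] [IsNonarchimedeanLocalField K₂] [CharZero K₂]
    (β : absoluteGaloisGroup K₁ ≃ₜ* absoluteGaloisGroup K₂) {σ : absoluteGaloisGroup K₁}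
    (hσ : IsFrobPow σ 1) : IsFrobPow (β σ) 1 := by
  obtain ⟨hp₁, hv₁⟩ := prime_ringChar_residueField_and_valuation_lt_one (K := K₁)
  obtain ⟨hp₂, hv₂⟩ := prime_ringChar_residueField_and_valuation_lt_one (K := K₂)
  haveI : Fact (ringChar 𝓀[K₁]).Prime := ⟨hp₁⟩
  haveI : Fact (ringChar 𝓀[K₂]).Prime := ⟨hp₂⟩
  letI := LocalField.padicAlgebra K₁ (ringChar 𝓀[K₁]) hv₁
  letI := LocalField.padicAlgebra K₂ (ringChar 𝓀[K₂]) hv₂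
  haveI : FiniteDimensional ℚ_[ringChar 𝓀[K₁]] K₁ :=
    Literature.NumberTheory.PAdicHodge.PadicBase.instFiniteDimensional (F := K₁) hv₁
  haveI : FiniteDimensional ℚ_[ringChar 𝓀[K₂]] K₂ :=
    Literature.NumberTheory.PAdicHodge.PadicBase.instFiniteDimensional (F := K₂) hv₂
  rw [← isFrobeniusLiftMLF_iff_isFrobPow_one (K := K₂) rfl]
  exact galoisMLF_iso_frobenius_holds (ringChar 𝓀[K₁]) (ringChar 𝓀[K₂]) K₁ K₂ β σ
    ((isFrobeniusLiftMLF_iff_isFrobPow_one (K := K₁) rfl σ).mpr hσ)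

section Pair

variable {K₁ K₂ : Type} [Field K₁] [ValuativeRel K₁] [TopologicalSpace K₁]
  [IsNonarchimedeanLocalField K₁] [Field K₂] [ValuativeRel K₂] [TopologicalSpace K₂]
  [IsNonarchimedeanLocalField K₂]
  {E₁ : Type} [Field E₁] [Algebra K₁ E₁] [FiniteDimensional K₁ E₁] [Algebra.IsSeparable K₁ E₁]
  [Normal K₁ E₁] [ValuativeRel E₁] [TopologicalSpace E₁] [IsNonarchimedeanLocalField E₁]
  [ValuativeExtension K₁ E₁] [CharZero E₁]
  {E₂ : Type} [Field E₂] [Algebra K₂ E₂] [FiniteDimensional K₂ E₂] [Algebra.IsSeparable K₂ E₂]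
  [Normal K₂ E₂] [ValuativeRel E₂] [TopologicalSpace E₂] [IsNonarchimedeanLocalField E₂]
  [ValuativeExtension K₂ E₂] [CharZero E₂]

omit [Normal K₁ E₁] [CharZero E₁] [ValuativeRel E₁] [TopologicalSpace E₁]
  [IsNonarchimedeanLocalField E₁] [ValuativeExtension K₁ E₁] in
/-- **A reciprocity map characterised by Serre's `θ_E` is unique** (two homomorphisms
`Art, Art' : E₀ˣ → Gal(F̄/E₀)^{ab}` with the characterisation clause agree; Cassels–Fröhlich VI
§2.3). [cite: MochizukiAbsAnab2004, §1.2 p.9] -/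
theorem levelArt_unique
    {Art Art' : (embField K₁ E₁)ˣ →* TopologicalAbelianization (galFixing K₁ (embField K₁ E₁))}
    (hchar : ∀ (u : (embField K₁ E₁)ˣ) (h : galFixing K₁ (embField K₁ E₁)),
      Art u = QuotientGroup.mk h ↔
        ∀ (L' : IntermediateField E₁ (AlgebraicClosure E₁)) [FiniteDimensional E₁ L']
            [IsAbelianGalois E₁ L'],
          AlgEquiv.restrictNormalHom L' (absoluteGaloisGroup.toAlgEquiv E₁ (liftGal K₁ E₁ h.2)) =
            recSystemE (isClassFieldTheory_localWeilDatum K₁) L'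
              (Units.map ((equivEmbField K₁ E₁).symm : embField K₁ E₁ →* E₁) u))
    (hchar' : ∀ (u : (embField K₁ E₁)ˣ) (h : galFixing K₁ (embField K₁ E₁)),
      Art' u = QuotientGroup.mk h ↔
        ∀ (L' : IntermediateField E₁ (AlgebraicClosure E₁)) [FiniteDimensional E₁ L']
            [IsAbelianGalois E₁ L'],
          AlgEquiv.restrictNormalHom L' (absoluteGaloisGroup.toAlgEquiv E₁ (liftGal K₁ E₁ h.2)) =
            recSystemE (isClassFieldTheory_localWeilDatum K₁) L'
              (Units.map ((equivEmbField K₁ E₁).symm : embField K₁ E₁ →* E₁) u)) :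
    Art = Art' := by
  refine MonoidHom.ext fun u => ?_
  obtain ⟨h, hh⟩ := QuotientGroup.mk_surjective (Art u)
  rw [← hh, eq_comm, hchar' u h]
  exact (hchar u h).mp hh.symm

variable (α : absoluteGaloisGroup K₁ ≃ₜ* absoluteGaloisGroup K₂)
  (hN : ∀ g : absoluteGaloisGroup K₁,
    g ∈ galFixing K₁ (embField K₁ E₁) ↔ α g ∈ galFixing K₂ (embField K₂ E₂))

omit [ValuativeRel K₁] [TopologicalSpace K₁] [IsNonarchimedeanLocalField K₁]
  [ValuativeRel K₂] [TopologicalSpace K₂] [IsNonarchimedeanLocalField K₂]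
  [FiniteDimensional K₁ E₁] [Normal K₁ E₁] [ValuativeExtension K₁ E₁] [FiniteDimensional K₂ E₂]
  [Normal K₂ E₂] [ValuativeExtension K₂ E₂] in
/-- **[AbsAnab] Prop 1.2.1 (iii) transported to the level `E`**: with `Φᵢ : Gal(K̄ᵢ/Eᵢ⁰) ≅ Γ_{Eᵢ}`
(the lifts `liftGal`), the isomorphism `β = Φ₂ ∘ α| ∘ Φ₁⁻¹ : Γ_{E₁} ≅ Γ_{E₂}` satisfies
`β(liftGal₁ h) = liftGal₂ (α h)` and carries `I_{E₁}·[Γ,Γ]⁻` onto `I_{E₂}·[Γ,Γ]⁻`, `W_{E₁}·[Γ,Γ]⁻` onto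
`W_{E₂}·[Γ,Γ]⁻` ("`α^{ab}` preserves the images `Im(𝒪^×)`, `Im(K^×)`") and Frobenius elements to
Frobenius elements ((iv)). [cite: MochizukiAbsAnab2004, Prop 1.2.1 (iii) p.10] -/
theorem liftGal_map_mem_iff (h : galFixing K₁ (embField K₁ E₁)) :
    (liftGal K₁ E₁ h.2 ∈ absInertia E₁ ⊔ (commutator (absoluteGaloisGroup E₁)).topologicalClosure ↔
      liftGal K₂ E₂ ((hN h).mp h.2) ∈
        absInertia E₂ ⊔ (commutator (absoluteGaloisGroup E₂)).topologicalClosure) ∧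
    (liftGal K₁ E₁ h.2 ∈ weilSubgroup E₁ ⊔ (commutator (absoluteGaloisGroup E₁)).topologicalClosure ↔
      liftGal K₂ E₂ ((hN h).mp h.2) ∈
        weilSubgroup E₂ ⊔ (commutator (absoluteGaloisGroup E₂)).topologicalClosure) ∧
    (IsFrobPow (liftGal K₁ E₁ h.2) 1 → IsFrobPow (liftGal K₂ E₂ ((hN h).mp h.2)) 1) ∧
    (IsFrobPow (liftGal K₂ E₂ ((hN h).mp h.2)) 1 → IsFrobPow (liftGal K₁ E₁ h.2) 1) := by
  obtain ⟨Φ₁, hΦ₁⟩ := exists_continuousMulEquiv_galFixing_embField K₁ E₁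
  obtain ⟨Φ₂, hΦ₂⟩ := exists_continuousMulEquiv_galFixing_embField K₂ E₂
  -- the restriction `α| : Gal(K̄₁/E₁⁰) ≃ₜ* Gal(K̄₂/E₂⁰)`
  let αr : galFixing K₁ (embField K₁ E₁) ≃ₜ* galFixing K₂ (embField K₂ E₂) :=
    { toFun := fun g => ⟨α g, (hN g).mp g.2⟩
      invFun := fun g' => ⟨α.symm g', (hN _).mpr (by rw [α.apply_symm_apply]; exact g'.2)⟩
      left_inv := fun g => Subtype.ext (α.symm_apply_apply (g : absoluteGaloisGroup K₁))
      right_inv := fun g' => Subtype.ext (α.apply_symm_apply (g' : absoluteGaloisGroup K₂))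
      map_mul' := fun g g' => Subtype.ext (map_mul α _ _)
      continuous_toFun := (α.continuous.comp continuous_subtype_val).subtype_mk _
      continuous_invFun := (α.symm.continuous.comp continuous_subtype_val).subtype_mk _ }
  let β : absoluteGaloisGroup E₁ ≃ₜ* absoluteGaloisGroup E₂ := (Φ₁.symm.trans αr).trans Φ₂
  have hβ : β (liftGal K₁ E₁ h.2) = liftGal K₂ E₂ ((hN h).mp h.2) := by
    change Φ₂ (αr (Φ₁.symm (liftGal K₁ E₁ h.2))) = _
    rw [← hΦ₁ h, Φ₁.symm_apply_apply, hΦ₂]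
  obtain ⟨hI, hW⟩ := galoisMLF_iso_unitImage_holds E₁ E₂ β
  have hmemI : ∀ σ, β σ ∈ absInertia E₂ ⊔ (commutator (absoluteGaloisGroup E₂)).topologicalClosure ↔
      σ ∈ absInertia E₁ ⊔ (commutator (absoluteGaloisGroup E₁)).topologicalClosure := fun σ => by
    rw [← hI, Subgroup.mem_map]
    exact ⟨fun ⟨τ, hτ, hτσ⟩ => by rwa [← β.injective hτσ], fun hσ => ⟨σ, hσ, rfl⟩⟩
  have hmemW : ∀ σ, β σ ∈ weilSubgroup E₂ ⊔ (commutator (absoluteGaloisGroup E₂)).topologicalClosure ↔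
      σ ∈ weilSubgroup E₁ ⊔ (commutator (absoluteGaloisGroup E₁)).topologicalClosure := fun σ => by
    rw [← hW, Subgroup.mem_map]
    exact ⟨fun ⟨τ, hτ, hτσ⟩ => by rwa [← β.injective hτσ], fun hσ => ⟨σ, hσ, rfl⟩⟩
  refine ⟨?_, ?_, ?_, ?_⟩
  · rw [← hβ, hmemI]
  · rw [← hβ, hmemW]
  · intro h1
    rw [← hβ]
    exact isFrobPow_one_map_of_continuousMulEquiv β h1
  · intro h2
    have := isFrobPow_one_map_of_continuousMulEquiv β.symm h2
    rwa [← hβ, β.symm_apply_apply] at this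

variable {Art₁ : (embField K₁ E₁)ˣ →* TopologicalAbelianization (galFixing K₁ (embField K₁ E₁))}
  {Art₂ : (embField K₂ E₂)ˣ →* TopologicalAbelianization (galFixing K₂ (embField K₂ E₂))}
  (hchar₁ : ∀ (u : (embField K₁ E₁)ˣ) (h : galFixing K₁ (embField K₁ E₁)),
    Art₁ u = QuotientGroup.mk h ↔
      ∀ (L' : IntermediateField E₁ (AlgebraicClosure E₁)) [FiniteDimensional E₁ L']
          [IsAbelianGalois E₁ L'],
        AlgEquiv.restrictNormalHom L' (absoluteGaloisGroup.toAlgEquiv E₁ (liftGal K₁ E₁ h.2)) =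
          recSystemE (isClassFieldTheory_localWeilDatum K₁) L'
            (Units.map ((equivEmbField K₁ E₁).symm : embField K₁ E₁ →* E₁) u))
  (hchar₂ : ∀ (u : (embField K₂ E₂)ˣ) (h : galFixing K₂ (embField K₂ E₂)),
    Art₂ u = QuotientGroup.mk h ↔
      ∀ (L' : IntermediateField E₂ (AlgebraicClosure E₂)) [FiniteDimensional E₂ L']
          [IsAbelianGalois E₂ L'],
        AlgEquiv.restrictNormalHom L' (absoluteGaloisGroup.toAlgEquiv E₂ (liftGal K₂ E₂ h.2)) =
          recSystemE (isClassFieldTheory_localWeilDatum K₂) L'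
            (Units.map ((equivEmbField K₂ E₂).symm : embField K₂ E₂ →* E₂) u))

include hN hchar₁ hchar₂ in
omit [Normal K₁ E₁] [Normal K₂ E₂] in
/-- Existence half of the level transport: for every `u ∈ E₁⁰ˣ` there is `u₂ ∈ E₂⁰ˣ` with
`Art₂ u₂ = [α h]` where `Art₁ u = [h]` — because `α h` represents a Weil class of `E₂`
(Prop 1.2.1 (iii), "`Im(K^×)` preserved"). [cite: MochizukiAbsAnab2004, Prop 1.2.1 (iii) p.10] -/
theorem exists_levelArt₂_eq_of_levelArt₁_eq {u : (embField K₁ E₁)ˣ}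
    {h : galFixing K₁ (embField K₁ E₁)} (H : Art₁ u = QuotientGroup.mk h) :
    ∃ u₂ : (embField K₂ E₂)ˣ,
      Art₂ u₂ = QuotientGroup.mk (⟨α h, (hN h).mp h.2⟩ : galFixing K₂ (embField K₂ E₂)) :=
  exists_levelArt_eq_mk_of_mem_weil_sup hchar₂ _
    (((liftGal_map_mem_iff α hN h).2.1).mp (liftGal_mem_weil_sup_of_levelArt_eq hchar₁ H))

include hN hchar₁ hchar₂ in
omit [Normal K₁ E₁] [Normal K₂ E₂] in
/-- Surjectivity half: every `u₂ ∈ E₂⁰ˣ` is reached — `Art₂ u₂ = [α h]` with `Art₁ u = [h]` for some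
`u` (apply Prop 1.2.1 (iii) to `α⁻¹`). [cite: MochizukiAbsAnab2004, Prop 1.2.1 (iii) p.10] -/
theorem exists_levelArt₁_eq_of_levelArt₂_eq (u₂ : (embField K₂ E₂)ˣ) :
    ∃ (u : (embField K₁ E₁)ˣ) (h : galFixing K₁ (embField K₁ E₁)),
      Art₁ u = QuotientGroup.mk h ∧
        Art₂ u₂ = QuotientGroup.mk (⟨α h, (hN h).mp h.2⟩ : galFixing K₂ (embField K₂ E₂)) := by
  obtain ⟨h₂, hh₂⟩ := QuotientGroup.mk_surjective (Art₂ u₂)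
  have hmem : α.symm (h₂ : absoluteGaloisGroup K₂) ∈ galFixing K₁ (embField K₁ E₁) :=
    (hN _).mpr (by rw [α.apply_symm_apply]; exact h₂.2)
  let h : galFixing K₁ (embField K₁ E₁) := ⟨α.symm h₂, hmem⟩
  have hh : (⟨α h, (hN h).mp h.2⟩ : galFixing K₂ (embField K₂ E₂)) = h₂ :=
    Subtype.ext (α.apply_symm_apply (h₂ : absoluteGaloisGroup K₂))
  have hw₂ := liftGal_mem_weil_sup_of_levelArt_eq hchar₂ hh₂.symm
  have hw₁ : liftGal K₁ E₁ h.2 ∈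
      weilSubgroup E₁ ⊔ (commutator (absoluteGaloisGroup E₁)).topologicalClosure := by
    rw [(liftGal_map_mem_iff α hN h).2.1,
      liftGal_congr K₂ E₂ ((hN h).mp h.2) h₂.2 (α.apply_symm_apply (h₂ : absoluteGaloisGroup K₂))]
    exact hw₂
  obtain ⟨u, hu⟩ := exists_levelArt_eq_mk_of_mem_weil_sup hchar₁ h hw₁
  exact ⟨u, h, hu, by rw [hh, hh₂]⟩

/-- **The level isomorphism `ψ_E : E₁⁰ˣ ⥲ E₂⁰ˣ`** ([AbsAnab] proof of Prop 1.2.1 p. 11, "group-theoretic,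
by (iii)": `Art_{E₂}⁻¹ ∘ (α|)^{ab} ∘ Art_{E₁}`): for MLFs `K₁, K₂`, an isomorphism `α : G_{K₁} ≅ G_{K₂}`
and finite Galois `E₁/K₁`, `E₂/K₂` with `α(Gal(K̄₁/E₁⁰)) = Gal(K̄₂/E₂⁰)`, there is a multiplicative
isomorphism `ψ : E₁⁰ˣ ⥲ E₂⁰ˣ` such that (1) `Art₂ (ψ u) = [α h]` whenever `Art₁ u = [h]`, for every pair
of reciprocity maps characterised by Serre's `θ` (uniqueness, `levelArt_unique`); (2) `ψ` is
`α`-equivariant for the action of `Γ_{K₁}` on the normal subextension `E₁⁰` (Neukirch IV (5.8));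
(3) `ψ` carries units onto units (Prop 1.2.1 (iii), "`Im(𝒪^×)`"); (4) `ψ` carries uniformisers to
uniformisers (Prop 1.2.1 (iv), "Frobenius elements").  Universe `0`.
[cite: MochizukiAbsAnab2004, Prop 1.2.1 (iii) p.11] -/
theorem exists_levelIso :
    ∃ ψ : (embField K₁ E₁)ˣ ≃* (embField K₂ E₂)ˣ,
      (∀ {Art₁ : (embField K₁ E₁)ˣ →* TopologicalAbelianization (galFixing K₁ (embField K₁ E₁))}
        {Art₂ : (embField K₂ E₂)ˣ →* TopologicalAbelianization (galFixing K₂ (embField K₂ E₂))},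
        (∀ (u : (embField K₁ E₁)ˣ) (h : galFixing K₁ (embField K₁ E₁)),
          Art₁ u = QuotientGroup.mk h ↔
            ∀ (L' : IntermediateField E₁ (AlgebraicClosure E₁)) [FiniteDimensional E₁ L']
                [IsAbelianGalois E₁ L'],
              AlgEquiv.restrictNormalHom L' (absoluteGaloisGroup.toAlgEquiv E₁ (liftGal K₁ E₁ h.2)) =
                recSystemE (isClassFieldTheory_localWeilDatum K₁) L'
                  (Units.map ((equivEmbField K₁ E₁).symm : embField K₁ E₁ →* E₁) u)) →
        (∀ (u : (embField K₂ E₂)ˣ) (h : galFixing K₂ (embField K₂ E₂)),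
          Art₂ u = QuotientGroup.mk h ↔
            ∀ (L' : IntermediateField E₂ (AlgebraicClosure E₂)) [FiniteDimensional E₂ L']
                [IsAbelianGalois E₂ L'],
              AlgEquiv.restrictNormalHom L' (absoluteGaloisGroup.toAlgEquiv E₂ (liftGal K₂ E₂ h.2)) =
                recSystemE (isClassFieldTheory_localWeilDatum K₂) L'
                  (Units.map ((equivEmbField K₂ E₂).symm : embField K₂ E₂ →* E₂) u)) →
        ∀ (u : (embField K₁ E₁)ˣ) (h : galFixing K₁ (embField K₁ E₁)), Art₁ u = QuotientGroup.mk h →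
          Art₂ (ψ u) = QuotientGroup.mk (⟨α h, (hN h).mp h.2⟩ : galFixing K₂ (embField K₂ E₂))) ∧
      (∀ (g : absoluteGaloisGroup K₁) (u u' : (embField K₁ E₁)ˣ),
        ((u' : embField K₁ E₁) : AlgebraicClosure K₁) = g • ((u : embField K₁ E₁) : AlgebraicClosure K₁) →
        ((ψ u' : embField K₂ E₂) : AlgebraicClosure K₂) =
          α g • ((ψ u : embField K₂ E₂) : AlgebraicClosure K₂)) ∧
      (∀ u : (embField K₁ E₁)ˣ,
        Units.map ((equivEmbField K₁ E₁).symm : embField K₁ E₁ →* E₁) u ∈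
            (valuation E₁).valuationSubring.unitGroup ↔
          Units.map ((equivEmbField K₂ E₂).symm : embField K₂ E₂ →* E₂) (ψ u) ∈
            (valuation E₂).valuationSubring.unitGroup) ∧
      (∀ u : (embField K₁ E₁)ˣ,
        (valuation E₁).IsUniformizer
            ((Units.map ((equivEmbField K₁ E₁).symm : embField K₁ E₁ →* E₁) u : E₁ˣ) : E₁) →
          (valuation E₂).IsUniformizer
            ((Units.map ((equivEmbField K₂ E₂).symm : embField K₂ E₂ →* E₂) (ψ u) : E₂ˣ) : E₂)) := by
  classical
  obtain ⟨Art₁, hinj₁, -, hequiv₁, hchar₁, -⟩ := exists_reciprocity_characterized_embField K₁ E₁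
  obtain ⟨Art₂, hinj₂, -, hequiv₂, hchar₂, -⟩ := exists_reciprocity_characterized_embField K₂ E₂
  -- `(α|)^{ab} : Gal(K̄₁/E₁⁰)^{ab} ⥲ Gal(K̄₂/E₂⁰)^{ab}`
  let αr : galFixing K₁ (embField K₁ E₁) ≃ₜ* galFixing K₂ (embField K₂ E₂) :=
    { toFun := fun g => ⟨α g, (hN g).mp g.2⟩
      invFun := fun g' => ⟨α.symm g', (hN _).mpr (by rw [α.apply_symm_apply]; exact g'.2)⟩
      left_inv := fun g => Subtype.ext (α.symm_apply_apply (g : absoluteGaloisGroup K₁))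
      right_inv := fun g' => Subtype.ext (α.apply_symm_apply (g' : absoluteGaloisGroup K₂))
      map_mul' := fun g g' => Subtype.ext (map_mul α _ _)
      continuous_toFun := (α.continuous.comp continuous_subtype_val).subtype_mk _
      continuous_invFun := (α.symm.continuous.comp continuous_subtype_val).subtype_mk _ }
  let T := abelianizationCongr αr
  have hT : ∀ h : galFixing K₁ (embField K₁ E₁), T (QuotientGroup.mk h) =
      QuotientGroup.mk (⟨α h, (hN h).mp h.2⟩ : galFixing K₂ (embField K₂ E₂)) := fun h =>
    abelianizationCongr_mk αr h
  -- existence, both ways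
  have hfwd : ∀ u : (embField K₁ E₁)ˣ, ∃ u₂ : (embField K₂ E₂)ˣ, Art₂ u₂ = T (Art₁ u) := by
    intro u
    obtain ⟨h, hh⟩ := QuotientGroup.mk_surjective (Art₁ u)
    obtain ⟨u₂, hu₂⟩ := exists_levelArt₂_eq_of_levelArt₁_eq α hN hchar₁ hchar₂ hh.symm
    exact ⟨u₂, by rw [hu₂, ← hh, hT]⟩
  have hbwd : ∀ u₂ : (embField K₂ E₂)ˣ, ∃ u : (embField K₁ E₁)ˣ, T (Art₁ u) = Art₂ u₂ := by
    intro u₂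
    obtain ⟨u, h, hu, hu₂⟩ := exists_levelArt₁_eq_of_levelArt₂_eq α hN hchar₁ hchar₂ u₂
    exact ⟨u, by rw [hu, hT, hu₂]⟩
  let ψ : (embField K₁ E₁)ˣ ≃* (embField K₂ E₂)ˣ :=
    { toFun := fun u => Classical.choose (hfwd u)
      invFun := fun u₂ => Classical.choose (hbwd u₂)
      left_inv := fun u => hinj₁ (T.injective (by
        rw [Classical.choose_spec (hbwd _), Classical.choose_spec (hfwd u)]))
      right_inv := fun u₂ => hinj₂ (by
        rw [Classical.choose_spec (hfwd _), Classical.choose_spec (hbwd u₂)])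
      map_mul' := fun u v => hinj₂ (by
        rw [Classical.choose_spec (hfwd _), map_mul, map_mul, map_mul,
          Classical.choose_spec (hfwd u), Classical.choose_spec (hfwd v)]) }
  have hψ : ∀ u, Art₂ (ψ u) = T (Art₁ u) := fun u => Classical.choose_spec (hfwd u)
  -- `Art₁ u = [h] ⇒ Art₂ (ψ u) = [α h]`
  have hψ' : ∀ (u : (embField K₁ E₁)ˣ) (h : galFixing K₁ (embField K₁ E₁)), Art₁ u = QuotientGroup.mk h →
      Art₂ (ψ u) = QuotientGroup.mk (⟨α h, (hN h).mp h.2⟩ : galFixing K₂ (embField K₂ E₂)) := by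
    intro u h H
    rw [hψ, H, hT]
  refine ⟨ψ, ?_, ?_, ?_, ?_⟩
  · -- (1) for every characterised pair of reciprocity maps
    intro Art₁' Art₂' hchar₁' hchar₂' u h H
    have e₁ := levelArt_unique hchar₁' hchar₁
    have e₂ := levelArt_unique (K₁ := K₂) (E₁ := E₂) hchar₂' hchar₂
    subst e₁ e₂
    exact hψ' u h H
  · -- (2) `α`-equivariance
    intro g u u' hu'
    haveI := normal_embField K₂ E₂
    obtain ⟨h, hh⟩ := QuotientGroup.mk_surjective (Art₁ u)
    let h' : galFixing K₁ (embField K₁ E₁) := ⟨g * h * g⁻¹, conj_mem_galFixing K₁ E₁ g h.2⟩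
    have H₁' : Art₁ u' = QuotientGroup.mk h' := hequiv₁ g u u' h h' hu' rfl hh.symm
    have H₂' := hψ' u' h' H₁'
    have H₂ := hψ' u h hh.symm
    -- the unit `α g • ψ u` of `E₂⁰`
    let τ := (absoluteGaloisGroup.toAlgEquiv K₂ (α g)).restrictNormal (embField K₂ E₂)
    let x' : (embField K₂ E₂)ˣ := Units.map (τ : embField K₂ E₂ →* embField K₂ E₂) (ψ u)
    have hx' : ((x' : embField K₂ E₂) : AlgebraicClosure K₂) =
        α g • ((ψ u : embField K₂ E₂) : AlgebraicClosure K₂) := by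
      rw [absoluteGaloisGroup.smul_def]
      exact AlgEquiv.restrictNormal_commutes _ (embField K₂ E₂) _
    let k' : galFixing K₂ (embField K₂ E₂) :=
      ⟨α g * α h * (α g)⁻¹, conj_mem_galFixing K₂ E₂ (α g) ((hN h).mp h.2)⟩
    have H₃ : Art₂ x' = QuotientGroup.mk k' :=
      hequiv₂ (α g) (ψ u) x' ⟨α h, (hN h).mp h.2⟩ k' hx' rfl H₂
    have hk : (⟨α h', (hN h').mp h'.2⟩ : galFixing K₂ (embField K₂ E₂)) = k' :=
      Subtype.ext (by change α (g * h * g⁻¹) = α g * α h * (α g)⁻¹; rw [map_mul, map_mul, map_inv])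
    rw [hk, ← H₃] at H₂'
    rw [hinj₂ H₂', hx']
  · -- (3) units
    intro u
    obtain ⟨h, hh⟩ := QuotientGroup.mk_surjective (Art₁ u)
    rw [← liftGal_mem_inertia_sup_iff_of_levelArt_eq hchar₁ hh.symm,
      ← liftGal_mem_inertia_sup_iff_of_levelArt_eq hchar₂ (hψ' u h hh.symm)]
    exact (liftGal_map_mem_iff α hN h).1
  · -- (4) uniformisers
    intro u hϖ
    obtain ⟨h, hh⟩ := QuotientGroup.mk_surjective (Art₁ u)
    exact isUniformizer_of_levelArt_eq_of_isFrobPow hchar₂ (hψ' u h hh.symm)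
      ((liftGal_map_mem_iff α hN h).2.2.1 (isFrobPow_liftGal_of_levelArt_eq hchar₁ hh.symm hϖ))

end Pair

end Literature.AnabelianGeometry.AbsoluteAnabelian
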